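import Summits.Ventures.PercRepro.C026Independence
import Summits.Ventures.PercRepro.C026GluingDefs
import Summits.Ventures.PercRepro.C026ProdCFGluingDict

/-!
# The two sides of a 3-terminal gluing are independent at every weight vector (p6, gen 15)

For p6's gluing `IsGluing a b c side` (`C026GluingDefs`), an event read off the `true`-side restriction
and one read off the `false`-side restriction are independent (`prob_inter_eq_mul_of_sides`, from
`C026Independence`).  With p5's dictionary (`isoMark_gluing_iff`, `C026ProdCFGluingDict`) the
isolation of a mark from the other two — the four coordinates `Z, Mₐ, M_b, K` of mine-3's C-028 state
(MINE3-GLUING §2) — MULTIPLIES over the gluing at every `p` (`prob_isoMark_gluing`): the first lemma of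
the forest-class theorem (C-035 on every `G` with `G − a − b` a forest, via LEMMA G2 = `C026GluingG2`).
-/

namespace PercRepro

open Finset

variable {E : Type*} [Fintype E] [DecidableEq E]

/-- The edges of colour `s`. -/
noncomputable def sideEdgesOf (side : E → Bool) (s : Bool) : Finset E :=
  univ.filter fun e => side e = s

omit [DecidableEq E] in
/-- An event read off the side-`s` restriction depends only on the side-`s` edges. -/
theorem dependsOn_sideRestrict (side : E → Bool) (s : Bool) (P : Config {e // side e = s} → Prop) :
    DependsOn (sideEdgesOf side s) {ω | P (sideRestrict ω side s)} := by
  intro ω ω' h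
  have : sideRestrict ω side s = sideRestrict ω' side s := by
    funext e
    exact h e.1 (by simp [sideEdgesOf, e.2])
  simp only [Set.mem_setOf_eq, this]

/-- The complement colour's edges are the complement of the colour's edges. -/
theorem sideEdgesOf_not (side : E → Bool) (s : Bool) : sideEdgesOf side (!s) = (sideEdgesOf side s)ᶜ := by
  ext e
  simp only [sideEdgesOf, Finset.mem_filter, Finset.mem_univ, true_and, Finset.mem_compl]
  cases s <;> cases h : side e <;> simp

/-- **Independence of the two sides of a gluing**: an event of the `true` side and an event of the
`false` side are independent. -/
theorem prob_inter_eq_mul_of_sides (p : E → ℝ) (side : E → Bool)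
    (P : Config {e // side e = true} → Prop) (Q : Config {e // side e = false} → Prop) :
    prob p ({ω | P (sideRestrict ω side true)} ∩ {ω | Q (sideRestrict ω side false)}) =
      prob p {ω | P (sideRestrict ω side true)} * prob p {ω | Q (sideRestrict ω side false)} := by
  refine prob_inter_eq_mul_of_dependsOn p (dependsOn_sideRestrict side true P) ?_
  have h := dependsOn_sideRestrict side false Q
  have hc : sideEdgesOf side false = (sideEdgesOf side true)ᶜ := sideEdgesOf_not side true
  rw [← hc]
  exact h

namespace MultiGraph

variable {V : Type*} (G : MultiGraph V E)

/-- **A mark's isolation multiplies over a gluing at every weight vector** (the coordinates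
`Z, Mₐ, M_b, K` of mine-3's C-028 state): `P(m iso) = P(m iso in the true part)·P(m iso in the false part)`. -/
theorem prob_isoMark_gluing {a b c : V} {side : E → Bool} (hg : G.IsGluing a b c side) (p : E → ℝ)
    {m x y : V} (hcover : ∀ w, (w = a ∨ w = b ∨ w = c) → w ≠ m → w = x ∨ w = y) :
    prob p {ω | G.IsoMark ω m x y} =
      prob p {ω | (G.part side true).IsoMark (sideRestrict ω side true) m x y} *
        prob p {ω | (G.part side false).IsoMark (sideRestrict ω side false) m x y} := by
  rw [← prob_inter_eq_mul_of_sides p side (fun τ => (G.part side true).IsoMark τ m x y)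
    (fun τ => (G.part side false).IsoMark τ m x y)]
  congr 1
  ext ω
  simp only [Set.mem_setOf_eq, Set.mem_inter_iff]
  exact G.isoMark_gluing_iff hg ω hcover

end MultiGraph

end PercRepro
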